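import Mathlib
import Literature.Analysis.ValidatedNumerics.AffineArithmetic
import HarnessLib

/-!
# ζ(5) search — BARRIER: CRITICAL VALUES ON BOXES — kernel arithmetic I: sparse integer polynomials in noise variables

HONEST FRAMING (cell `pub-zeta5`): systematic search; no irrationality claim unless kernel-certified. Problem-independent
kernel ARITHMETIC used by the box certificates for the critical values `C₀`, `C₁` of `ConeGammaRates` (theory seat
cert-2 g37, item «CRITICAL VALUES ON BOXES — KERNEL», INBOX plan/ruling 2026-08-27): nothing here is about
Brown–Zudilin's objects, any γ, C2 (OPEN), S-E (CONJECTURED) or `ζ(5)`.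

`EPoly` — sparse polynomials `Σ c·Π_i ε_i^{e_i}` with INTEGER coefficients in noise variables `ε₀, ε₁, …` (exponent
vectors as lists; duplicates allowed, the value is the sum), with exact `merge`-addition (structural recursion, sorted
inputs stay sorted — efficiency only), `mul` (schoolbook, shorter factor outside), `pow`, and the range bounds
`lower P ≤ P(ε) ≤ upper P` (constant terms exact, all-even monomials one-sided), `|P(ε)| ≤ absSum P` for admissible noise
`|ε_i| ≤ 1` (the tree's `AForm.Valid`); soundness `eval_merge`, `eval_mul`, `eval_smul`, `eval_pow`, `lower_le_eval`.
Used to decide the SIGNS of polynomial systems composed EXACTLY with affinely moving points (Poincaré–Miranda face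
conditions), where first-order arithmetic loses the cancellations.
-/

open Finset

namespace Summit.KontsevichZagierPeriods.Zeta5Search.Barrier.ConeGamma

/-! ## Sparse integer polynomials in the noise variables -/

/-- A sparse polynomial with integer coefficients in variables `ε₀, ε₁, …`: a list of terms
`(exponent vector, coefficient)`, standing for `Σ c · Π_i ε_i ^ e_i`. Duplicate exponent vectors are allowed
(the value is the sum over the list). -/
abbrev EPoly : Type := List (List ℕ × ℤ)

namespace EPoly

/-- Value of the monomial `Π_i ε_i ^ e_i` (structural recursion, shifting `ε`). -/
def evalMono : (ℕ → ℝ) → List ℕ → ℝ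
  | _, [] => 1
  | ε, e :: es => ε 0 ^ e * evalMono (fun i => ε (i + 1)) es

/-- Value of a term list. -/
def eval (ε : ℕ → ℝ) : EPoly → ℝ
  | [] => 0
  | t :: p => (t.2 : ℝ) * evalMono ε t.1 + eval ε p

/-- Lexicographic comparison of exponent vectors (missing entries read as `0`; structural in the first list). -/
def cmpExp : List ℕ → List ℕ → Ordering
  | [], b => if b.all (· == 0) then .eq else .lt
  | e :: es, [] => if e = 0 then cmpExp es [] else .gt
  | e :: es, f :: fs => if e < f then .lt else if f < e then .gt else cmpExp es fs

/-- Sum of exponent vectors (zero-padded). -/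
def zipAdd : List ℕ → List ℕ → List ℕ
  | [], b => b
  | a, [] => a
  | x :: a, y :: b => (x + y) :: zipAdd a b

/-- Merge two term lists, combining terms whose exponent vectors compare `eq` (structural recursion: the
recursive call on the first list is passed to the inner recursion on the second). -/
def merge : EPoly → EPoly → EPoly
  | [], q => q
  | t :: p, q => mergeAux t p (merge p) q
where
  /-- inner loop of `merge`: insert the pending term `t` (followed by `p`, merged by `rec`) into `q` -/
  mergeAux (t : List ℕ × ℤ) (p : EPoly) (rec : EPoly → EPoly) : EPoly → EPoly
  | [] => t :: p
  | u :: q => match cmpExp t.1 u.1 with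
    | .lt => t :: rec (u :: q)
    | .gt => u :: mergeAux t p rec q
    | .eq => (t.1, t.2 + u.2) :: rec q

/-- Constant polynomial. -/
def const (c : ℤ) : EPoly := [([], c)]

/-- The variable `ε_j` times `c`. -/
def var (c : ℤ) (j : ℕ) : EPoly := [(List.replicate j 0 ++ [1], c)]

/-- Integer multiple. -/
def smul (k : ℤ) (p : EPoly) : EPoly := p.map fun t => (t.1, k * t.2)

/-- Product with a monomial `c · ε^m`. -/
def mulMono (m : List ℕ) (c : ℤ) (p : EPoly) : EPoly := p.map fun t => (zipAdd m t.1, c * t.2)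

/-- Product (schoolbook, merging like terms), outer loop over the first factor. -/
def mulCore (p q : EPoly) : EPoly := p.foldr (fun t acc => merge (mulMono t.1 t.2 q) acc) []

/-- Product: `mulCore` with the SHORTER factor in the outer loop (efficiency only). -/
def mul (p q : EPoly) : EPoly := if p.length ≤ q.length then mulCore p q else mulCore q p

/-- Power. -/
def pow (p : EPoly) : ℕ → EPoly
  | 0 => const 1
  | n + 1 => mul (pow p n) p

/-- `Σ |c|` over the terms. -/
def absSum : EPoly → ℕ
  | [] => 0
  | t :: p => t.2.natAbs + absSum p

/-- Lower range end over `|ε_i| ≤ 1`: constant terms count `c`, all-even monomials `min(c,0)` (their value lies in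
`[0,1]`), the others `−|c|`. -/
def lower : EPoly → ℤ
  | [] => 0
  | t :: p => (if t.1.all (· == 0) then t.2 else if t.1.all (· % 2 == 0) then min t.2 0 else -(t.2.natAbs : ℤ))
      + lower p

/-- Upper range end: constant terms `c`, all-even monomials `max(c,0)`, the others `|c|`. -/
def upper : EPoly → ℤ
  | [] => 0
  | t :: p => (if t.1.all (· == 0) then t.2 else if t.1.all (· % 2 == 0) then max t.2 0 else (t.2.natAbs : ℤ))
      + upper p

variable {ε : ℕ → ℝ}

open Literature.Analysis.ValidatedNumerics (AForm)
open Literature.Analysis.ValidatedNumerics.AForm (Valid)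

/-- `eval` of the empty list. -/
@[simp] theorem eval_nil : eval ε [] = 0 := rfl

/-- `eval` of a cons. -/
@[simp] theorem eval_cons (t : List ℕ × ℤ) (p : EPoly) :
    eval ε (t :: p) = (t.2 : ℝ) * evalMono ε t.1 + eval ε p := rfl

/-- `eval` is additive over appends. -/
theorem eval_append (p q : EPoly) : eval ε (p ++ q) = eval ε p + eval ε q := by
  induction p with
  | nil => simp
  | cons t p ih => simp [ih, add_assoc]

/-- `|ε^m| ≤ 1`. -/
theorem abs_evalMono_le (h : Valid ε) (m : List ℕ) : |evalMono ε m| ≤ 1 := by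
  induction m generalizing ε with
  | nil => simp [evalMono]
  | cons e es ih =>
    simp only [evalMono, abs_mul, abs_pow]
    have h1 : |ε 0| ^ e ≤ 1 := pow_le_one₀ (abs_nonneg _) (h 0)
    have h2 := ih (Literature.Analysis.ValidatedNumerics.AForm.Valid.tail h)
    calc |ε 0| ^ e * |evalMono (fun i => ε (i + 1)) es| ≤ 1 * 1 :=
          mul_le_mul h1 h2 (abs_nonneg _) zero_le_one
      _ = 1 := one_mul 1

/-- An exponent vector of zeros evaluates to `1`. -/
theorem evalMono_eq_one_of_all (m : List ℕ) (hm : m.all (· == 0) = true) (ε : ℕ → ℝ) : evalMono ε m = 1 := by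
  induction m generalizing ε with
  | nil => rfl
  | cons e es ih =>
    simp only [List.all_cons, Bool.and_eq_true, beq_iff_eq] at hm
    simp [evalMono, hm.1, ih hm.2]

/-- An all-even monomial is non-negative. -/
theorem evalMono_nonneg_of_even (m : List ℕ) (hm : m.all (· % 2 == 0) = true) (ε : ℕ → ℝ) : 0 ≤ evalMono ε m := by
  induction m generalizing ε with
  | nil => simp [evalMono]
  | cons e es ih =>
    simp only [List.all_cons, Bool.and_eq_true, beq_iff_eq] at hm
    obtain ⟨k, hk⟩ : Even e := Nat.even_iff.2 hm.1
    simp only [evalMono]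
    refine mul_nonneg ?_ (ih hm.2 _)
    rw [hk, ← two_mul, pow_mul]
    positivity

/-- **Range bound**: `lower P ≤ P(ε) ≤ upper P` for valid noise. -/
theorem lower_le_eval (h : Valid ε) (p : EPoly) : (lower p : ℝ) ≤ eval ε p ∧ eval ε p ≤ (upper p : ℝ) := by
  induction p with
  | nil => simp [lower, upper]
  | cons t p ih =>
    simp only [lower, upper, eval_cons, Int.cast_add]
    have hm := abs_evalMono_le h t.1
    have hm' := abs_le.1 hm
    by_cases hc : t.1.all (· == 0) = true
    · rw [if_pos hc, if_pos hc, evalMono_eq_one_of_all t.1 hc]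
      constructor <;> linarith [ih.1, ih.2]
    · rw [if_neg hc, if_neg hc]
      by_cases he : t.1.all (· % 2 == 0) = true
      · rw [if_pos he, if_pos he]
        have h0 := evalMono_nonneg_of_even t.1 he ε
        have hmin : ((min t.2 0 : ℤ) : ℝ) ≤ (t.2 : ℝ) * evalMono ε t.1 := by
          rcases le_or_gt 0 t.2 with ht | ht
          · rw [min_eq_right ht]; push_cast; exact mul_nonneg (by exact_mod_cast ht) h0
          · rw [min_eq_left ht.le]
            have : (t.2 : ℝ) * evalMono ε t.1 ≥ (t.2 : ℝ) * 1 :=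
              mul_le_mul_of_nonpos_left hm'.2 (by exact_mod_cast ht.le)
            linarith
        have hmax : (t.2 : ℝ) * evalMono ε t.1 ≤ ((max t.2 0 : ℤ) : ℝ) := by
          rcases le_or_gt 0 t.2 with ht | ht
          · rw [max_eq_left ht]
            have : (t.2 : ℝ) * evalMono ε t.1 ≤ (t.2 : ℝ) * 1 :=
              mul_le_mul_of_nonneg_left hm'.2 (by exact_mod_cast ht)
            linarith
          · rw [max_eq_right ht.le]; push_cast
            exact mul_nonpos_of_nonpos_of_nonneg (by exact_mod_cast ht.le) h0
        constructor <;> linarith [ih.1, ih.2]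
      · rw [if_neg he, if_neg he]
        have hb : |(t.2 : ℝ) * evalMono ε t.1| ≤ |(t.2 : ℝ)| := by
          rw [abs_mul]
          calc |(t.2 : ℝ)| * |evalMono ε t.1| ≤ |(t.2 : ℝ)| * 1 :=
                mul_le_mul_of_nonneg_left hm (abs_nonneg _)
            _ = |(t.2 : ℝ)| := mul_one _
        have hb' := abs_le.1 hb
        have hn : ((t.2.natAbs : ℤ) : ℝ) = |(t.2 : ℝ)| := by push_cast [Nat.cast_natAbs, Int.cast_abs]; rfl
        rw [Int.cast_neg, hn]
        constructor <;> linarith [ih.1, ih.2, hb'.1, hb'.2]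

/-- `|P(ε)| ≤ absSum P` for valid noise. -/
theorem abs_eval_le (h : Valid ε) (p : EPoly) : |eval ε p| ≤ absSum p := by
  induction p with
  | nil => simp [absSum]
  | cons t p ih =>
    simp only [eval_cons, absSum, Nat.cast_add]
    refine (abs_add_le _ _).trans (add_le_add ?_ ih)
    rw [abs_mul, Nat.cast_natAbs, Int.cast_abs]
    calc |(t.2 : ℝ)| * |evalMono ε t.1| ≤ |(t.2 : ℝ)| * 1 :=
          mul_le_mul_of_nonneg_left (abs_evalMono_le h t.1) (abs_nonneg _)
      _ = |(t.2 : ℝ)| := mul_one _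

/-- `ε^(a+b) = ε^a ε^b`. -/
theorem evalMono_zipAdd (ε : ℕ → ℝ) (a b : List ℕ) : evalMono ε (zipAdd a b) = evalMono ε a * evalMono ε b := by
  induction a generalizing b ε with
  | nil => simp [zipAdd, evalMono]
  | cons x a ih =>
    cases b with
    | nil => simp [zipAdd, evalMono]
    | cons y b => simp [zipAdd, evalMono, ih, pow_add]; ring

/-- Exponent vectors that compare `eq` have equal monomial values. -/
theorem evalMono_eq_of_cmpExp : ∀ (a b : List ℕ) (ε : ℕ → ℝ), cmpExp a b = .eq → evalMono ε a = evalMono ε b := by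
  intro a
  induction a with
  | nil =>
    intro b ε h
    simp only [cmpExp] at h
    split_ifs at h with hb
    rw [evalMono, evalMono_eq_one_of_all b hb]
  | cons e es iha =>
    intro b
    cases b with
    | nil =>
      intro ε h
      simp only [cmpExp] at h
      split_ifs at h with he
      have := iha [] (fun i => ε (i + 1)) h
      simp [evalMono, he, this]
    | cons f fs =>
      intro ε h
      simp only [cmpExp] at h
      split_ifs at h with h1 h2
      have hef : e = f := by omega
      simp [evalMono, hef, iha fs _ h]

/-- The inner merge loop adds. -/
theorem eval_mergeAux (t : List ℕ × ℤ) (p : EPoly) {rec : EPoly → EPoly}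
    (hrec : ∀ q, eval ε (rec q) = eval ε p + eval ε q) (q : EPoly) :
    eval ε (merge.mergeAux t p rec q) = eval ε (t :: p) + eval ε q := by
  induction q with
  | nil => simp [merge.mergeAux]
  | cons u q ih =>
    simp only [merge.mergeAux]
    split
    · simp [hrec, add_assoc]
    · simp [ih]; ring
    · rename_i heq
      have hm := evalMono_eq_of_cmpExp _ _ ε heq
      simp [hrec, hm, Int.cast_add]; ring

/-- **`merge` is addition.** -/
theorem eval_merge (p q : EPoly) : eval ε (merge p q) = eval ε p + eval ε q := by
  induction p generalizing q with
  | nil => simp [merge]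
  | cons t p ih => rw [merge, eval_mergeAux t p ih q]

/-- `eval` of a constant. -/
@[simp] theorem eval_const (c : ℤ) : eval ε (const c) = c := by simp [const, evalMono]

/-- The monomial of `var`. -/
theorem evalMono_replicate_append (ε : ℕ → ℝ) (j : ℕ) : evalMono ε (List.replicate j 0 ++ [1]) = ε j := by
  induction j generalizing ε with
  | zero => simp [evalMono]
  | succ j ih => simp [List.replicate_succ, evalMono, ih]

/-- `eval` of a variable. -/
@[simp] theorem eval_var (c : ℤ) (j : ℕ) : eval ε (var c j) = c * ε j := by
  simp [var, evalMono_replicate_append]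

/-- `eval` of an integer multiple. -/
theorem eval_smul (k : ℤ) (p : EPoly) : eval ε (smul k p) = k * eval ε p := by
  induction p with
  | nil => simp [smul]
  | cons t p ih =>
    simp only [smul, List.map_cons, eval_cons, Int.cast_mul] at ih ⊢
    rw [ih]; ring

/-- `eval` of a monomial multiple. -/
theorem eval_mulMono (m : List ℕ) (c : ℤ) (p : EPoly) :
    eval ε (mulMono m c p) = c * evalMono ε m * eval ε p := by
  induction p with
  | nil => simp [mulMono]
  | cons t p ih =>
    simp only [mulMono, List.map_cons, eval_cons, Int.cast_mul, evalMono_zipAdd] at ih ⊢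
    rw [ih]; ring

/-- `mulCore` is multiplication. -/
theorem eval_mulCore (p q : EPoly) : eval ε (mulCore p q) = eval ε p * eval ε q := by
  induction p with
  | nil => simp [mulCore]
  | cons t p ih =>
    simp only [mulCore, List.foldr_cons] at ih ⊢
    rw [eval_merge, eval_mulMono, ih, eval_cons]; ring

/-- **`mul` is multiplication.** -/
theorem eval_mul (p q : EPoly) : eval ε (mul p q) = eval ε p * eval ε q := by
  unfold mul; split_ifs <;> rw [eval_mulCore]; ring

/-- `pow` is the power. -/
theorem eval_pow (p : EPoly) (n : ℕ) : eval ε (pow p n) = eval ε p ^ n := by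
  induction n with
  | zero => simp [pow]
  | succ n ih => rw [pow, eval_mul, ih, pow_succ]

end EPoly

end Summit.KontsevichZagierPeriods.Zeta5Search.Barrier.ConeGamma
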